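import Summits.KontsevichZagierPeriods.KontsevichZagierPeriods.Theorems.SoloBlindTriplication
import Summits.KontsevichZagierPeriods.KontsevichZagierPeriods.Theorems.SoloBlindLemniscateLine
import Literature.NumberTheory.Transcendental.FischlerRivoalCorollary1Reduction
import HarnessLib

/-!
# The octahedral involution at level 24 — functions and identities (solo-blind)

Preparation for `SoloBlindOcta`: along `t = v⁴` the integrands of `B((6j+1)/24, 1/6)`
(`j = 0,…,3`) pull back to `4 v^j (v(1-v⁴))^{-5/6}` on `(0,1)` — one rank-one local system on
`P¹` with the same monodromy `1/6` at the six vertices `0, ±1, ±i, ∞` of the octahedron, its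
three surplus zeros sitting at `∞`.  The octahedral rotation `ρ(v) = (1-v)/(1+v)` (order two,
axis through the edge midpoints `±(√2-1)`; it swaps `0 ↔ 1`, `∞ ↔ -1`, `i ↔ -i`) maps `(0,1)`
onto itself and satisfies the key identity `ρ(1-ρ⁴) = 8·v(1-v⁴)/(1+v)⁶`, whence the pull-back
formula `4E(ρ(v))|ρ'(v)| = 2·8^{-5/6} · 4(1+v)³E(v)` (`E = (v(1-v⁴))^{-5/6}`,
`2·8^{-5/6} = √2/4`).

Here: the constant `c = 2·8^{-5/6} ∈ K₀` with `0 < c < 1/2`; the involution `ρ` (self-inverse,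
image, derivative); the key identity and the pull-back formula; the pull-back along `t = v⁴`;
integrability (transported from the Beta integrand) and `ℚ`-semialgebraicity of the integrands.
-/

open Set MeasureTheory MvPolynomial

namespace Summit.KontsevichZagierPeriods.KontsevichZagierPeriods.Theorems

namespace SoloBlind

open Literature.ModelTheory.ExponentialFields (IsSemialgebraic)
open Literature.NumberTheory.Transcendental
open Literature.NumberTheory.Transcendental.KZ
open Literature.Analysis.SpecialFunctions.Selberg

noncomputable section

/-! ## The constant `c = 2·8^{-5/6}` -/

/-- `8^{-5/6}` is algebraic. -/
theorem isAlgebraic_eight_rpow : IsAlgebraic ℚ ((8:ℝ) ^ (-(5 / 6 : ℝ))) := by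
  have h := Literature.NumberTheory.Transcendental.isAlgebraic_rpow_ratCast (α := (8:ℝ))
    (by simpa using isAlgebraic_rat ℚ (A := ℝ) 8) (by norm_num) (-(5 / 6))
  push_cast at h
  exact h

/-- `c = 2·8^{-5/6}` (`= √2/4`), the constant of the pull-back along `ρ`. -/
def octC : ℝ := 2 * (8:ℝ) ^ (-(5 / 6 : ℝ))

/-- `c` as an element of `K₀`. -/
def octCK : K₀ := 2 * ⟨_, mem_K₀_iff.mpr isAlgebraic_eight_rpow⟩

/-- `(c : ℝ) = c`. -/
@[simp] theorem coe_octCK : ((octCK : K₀) : ℝ) = octC := by unfold octCK octC; push_cast; rfl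

/-- `c` is algebraic. -/
theorem isAlgebraic_octC : IsAlgebraic ℚ octC := by
  have h := mem_K₀_iff.mp octCK.2
  rwa [coe_octCK] at h

/-- `0 < c`. -/
theorem octC_pos : 0 < octC := by
  unfold octC
  exact mul_pos two_pos (Real.rpow_pos_of_pos (by norm_num) _)

/-- `8^{-2/3} = 1/4`. -/
theorem eight_rpow_neg_two_thirds : (8:ℝ) ^ (-(2 / 3 : ℝ)) = 1 / 4 := by
  rw [show (8:ℝ) = 2 ^ (3:ℝ) by norm_num, ← Real.rpow_mul zero_le_two,
    show (3:ℝ) * -(2 / 3) = -2 by norm_num, Real.rpow_neg zero_le_two]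
  norm_num

/-- `c < 1/2` (`8^{-5/6} < 8^{-2/3} = 1/4`). -/
theorem octC_lt_half : octC < 1 / 2 := by
  have h : (8:ℝ) ^ (-(5 / 6 : ℝ)) < (8:ℝ) ^ (-(2 / 3 : ℝ)) :=
    Real.rpow_lt_rpow_of_exponent_lt (by norm_num) (by norm_num)
  rw [eight_rpow_neg_two_thirds] at h
  unfold octC
  linarith

/-! ## The functions -/

/-- `P(v) = v(1-v⁴)`, the octahedral vertex form seen from the vertex `∞`. -/
def octP (v : ℝ) : ℝ := v * (1 - v ^ 4)

/-- `E(v) = P(v)^{-5/6}`. -/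
def octE (v : ℝ) : ℝ := octP v ^ (-(5 / 6 : ℝ))

/-- `P > 0` on `(0,1)`. -/
theorem octP_pos {v : ℝ} (hv : v ∈ Ioo (0:ℝ) 1) : 0 < octP v :=
  mul_pos hv.1 (by linarith [pow_four_lt_one hv])

/-! ## The involution `ρ` -/

/-- `ρ(v) = (1-v)/(1+v)`, the rotation by `π` of the octahedron `{0, ±1, ±i, ∞}` about the axis
through the edge midpoints `±(√2-1)`. -/
def octRho (v : ℝ) : ℝ := (1 - v) / (1 + v)

/-- `ρ'(v) = -2/(1+v)²`. -/
def octRho' (v : ℝ) : ℝ := -2 / (1 + v) ^ 2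

/-- `ρ` maps `(0,1)` into `(0,1)`. -/
theorem octRho_mem {v : ℝ} (hv : v ∈ Ioo (0:ℝ) 1) : octRho v ∈ Ioo (0:ℝ) 1 := by
  obtain ⟨h0, h1⟩ := hv
  refine ⟨div_pos (by linarith) (by linarith), ?_⟩
  unfold octRho
  rw [div_lt_one (by linarith)]
  linarith

/-- `ρ` is an involution. -/
theorem octRho_octRho {v : ℝ} (hv : 1 + v ≠ 0) : octRho (octRho v) = v := by
  unfold octRho
  have e1 : 1 - (1 - v) / (1 + v) = 2 * v / (1 + v) := by field_simp; ring
  have e2 : 1 + (1 - v) / (1 + v) = 2 / (1 + v) := by field_simp; ring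
  rw [e1, e2]
  field_simp

/-- `ρ` is injective on `(0,1)`. -/
theorem injOn_octRho : InjOn octRho (Ioo (0:ℝ) 1) := by
  intro x hx y hy h
  have hx' : 1 + x ≠ 0 := by linarith [hx.1]
  have hy' : 1 + y ≠ 0 := by linarith [hy.1]
  rw [← octRho_octRho hx', ← octRho_octRho hy', h]

/-- `ρ` maps `(0,1)` onto `(0,1)`. -/
theorem image_octRho : Ioo (0:ℝ) 1 = octRho '' Ioo (0:ℝ) 1 := by
  ext t
  constructor
  · intro ht
    exact ⟨octRho t, octRho_mem ht, octRho_octRho (by linarith [ht.1])⟩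
  · rintro ⟨v, hv, rfl⟩
    exact octRho_mem hv

/-- The derivative of `ρ`. -/
theorem hasDerivAt_octRho {v : ℝ} (hv : 1 + v ≠ 0) : HasDerivAt octRho (octRho' v) v := by
  have h1 : HasDerivAt (fun y : ℝ => 1 - y) (-1) v := by
    simpa using (hasDerivAt_id v).const_sub 1
  have h2 : HasDerivAt (fun y : ℝ => 1 + y) 1 v := by
    simpa using (hasDerivAt_id v).const_add 1
  have h := h1.div h2 hv
  refine h.congr_deriv ?_
  unfold octRho'
  field_simp
  ring

/-- `ρ` is `ℚ`-semialgebraic on `(0,1)`. -/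
theorem sa_octRho : IsSemialgebraicFunOn ℚ (line (Ioo (0:ℝ) 1)) (fun x : Fin 1 → ℝ => octRho (x 0)) :=
  IsSemialgebraicFunOn.div
    ((isSemialgebraicFunOn_aeval mix_line_sa (1 - X 0 : MvPolynomial (Fin 1) ℚ)).congr
      fun x _ => by simp)
    ((isSemialgebraicFunOn_aeval mix_line_sa (1 + X 0 : MvPolynomial (Fin 1) ℚ)).congr
      fun x _ => by simp)
    fun x hx => by
      have hx : x 0 ∈ Ioo (0:ℝ) 1 := hx
      exact (show (0:ℝ) < 1 + x 0 by linarith [hx.1]).ne'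

/-- **The key identity:** `P(ρ(v)) = 8 P(v)/(1+v)⁶`. -/
theorem oct_key {v : ℝ} (hv : v ∈ Ioo (0:ℝ) 1) : octP (octRho v) = 8 * octP v / (1 + v) ^ 6 := by
  have h : 1 + v ≠ 0 := by linarith [hv.1]
  unfold octP octRho
  field_simp
  ring

/-- `E(ρ(v)) = 8^{-5/6} (1+v)⁵ E(v)` on `(0,1)`. -/
theorem octE_rho {v : ℝ} (hv : v ∈ Ioo (0:ℝ) 1) :
    octE (octRho v) = (8:ℝ) ^ (-(5 / 6 : ℝ)) * ((1 + v) ^ 5 * octE v) := by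
  have h1 : 0 < 1 + v := by linarith [hv.1]
  have hP := octP_pos hv
  have hpow : ((1 + v) ^ 6 : ℝ) ^ (-(5 / 6 : ℝ)) = ((1 + v) ^ 5)⁻¹ := by
    rw [← Real.rpow_natCast (1 + v) 6, ← Real.rpow_mul h1.le,
      show ((6:ℕ):ℝ) * -(5 / 6) = -((5:ℕ):ℝ) by norm_num, Real.rpow_neg h1.le, Real.rpow_natCast]
  unfold octE
  rw [oct_key hv, Real.div_rpow (by positivity) (by positivity), Real.mul_rpow (by norm_num) hP.le,
    hpow]
  field_simp

/-- **Pull-back along `ρ`:** `c · 4(1+v)³E(v) = 4 ρ(v)⁰ E(ρ(v)) |ρ'(v)|` on `(0,1)`. -/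
theorem oct_pull {v : ℝ} (hv : v ∈ Ioo (0:ℝ) 1) :
    octC * (4 * ((1 + v) ^ 3 * octE v)) = 4 * (octRho v ^ 0 * octE (octRho v)) * |octRho' v| := by
  have h1 : 0 < 1 + v := by linarith [hv.1]
  have habs : |octRho' v| = 2 / (1 + v) ^ 2 := by
    unfold octRho'
    rw [neg_div, abs_neg, abs_of_pos (by positivity)]
  rw [habs, pow_zero, one_mul, octE_rho hv]
  unfold octC
  field_simp

/-! ## The pull-back along `t = v⁴` (the map itself is treated in `SoloBlindLemniscateLine`) -/

/-- `a_j = (6j+1)/24`: the first exponents `1/24, 7/24, 13/24, 19/24` of the four Betas. -/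
def octA (j : ℕ) : ℚ := (6 * j + 1) / 24

/-- `0 < a_j`. -/
theorem octA_pos (j : ℕ) : 0 < octA j := by unfold octA; positivity

/-- `(v⁴)^{a_j - 1} · 4v³ = 4 v^j v^{-5/6}` for `v > 0`. -/
theorem oct_quart_rpow {v : ℝ} (hv : 0 < v) (j : ℕ) :
    (v ^ 4) ^ ((octA j : ℝ) - 1) * (4 * v ^ 3) = 4 * (v ^ j * v ^ (-(5 / 6 : ℝ))) := by
  have q1 : (v ^ 4 : ℝ) ^ ((octA j : ℝ) - 1) = v ^ (4 * ((octA j : ℝ) - 1)) := by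
    rw [← Real.rpow_natCast v 4, ← Real.rpow_mul hv.le]
    norm_num
  have q2 : (v ^ 3 : ℝ) = v ^ (3:ℝ) := by
    rw [← Real.rpow_natCast]
    norm_num
  have q3 : v ^ (4 * ((octA j : ℝ) - 1)) * v ^ (3:ℝ) = v ^ ((j:ℝ) + -(5 / 6 : ℝ)) := by
    rw [← Real.rpow_add hv]
    congr 1
    unfold octA
    push_cast
    ring
  rw [q1, q2, mul_left_comm, q3, Real.rpow_add hv, Real.rpow_natCast]

/-- **Pull-back along `t = v⁴`:** `4 v^j E(v) = t^{a_j-1}(1-t)^{1/6-1}|4v³|` on `(0,1)`. -/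
theorem oct_quart {v : ℝ} (hv : v ∈ Ioo (0:ℝ) 1) (j : ℕ) :
    4 * (v ^ j * octE v) = betaFun (octA j) (1 / 6) (v ^ 4) * |4 * v ^ 3| := by
  have hv0 := hv.1
  have h4 : 0 < 1 - v ^ 4 := by linarith [pow_four_lt_one hv]
  rw [betaFun, abs_of_pos (by positivity), octE, octP, Real.mul_rpow hv0.le h4.le,
    show (((1 / 6 : ℚ) : ℝ) - 1) = -(5 / 6 : ℝ) by norm_num, mul_right_comm, oct_quart_rpow hv0 j]
  ring

/-! ## Integrability -/

/-- `4 v^j E(v)` is integrable on `(0,1)` (transport of the Beta integrand along `t = v⁴`). -/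
theorem integrableOn_octR (j : ℕ) : IntegrableOn (fun v => 4 * (v ^ j * octE v)) (Ioo 0 1) := by
  have h := integrableOn_betaFun (octA j) (1 / 6) (octA_pos j) (by norm_num)
  rw [image_pow_four, integrableOn_image_iff_integrableOn_abs_deriv_smul measurableSet_Ioo
    (fun v _ => hasDerivWithinAt_pow_four _ v) injOn_pow_four] at h
  exact h.congr_fun (fun v hv => by simp only [smul_eq_mul]; rw [mul_comm, ← oct_quart hv j])
    measurableSet_Ioo

/-- `c · 4(1+v)³E(v)` is integrable on `(0,1)`. -/
theorem integrableOn_octS :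
    IntegrableOn (fun v => octC * (4 * ((1 + v) ^ 3 * octE v))) (Ioo 0 1) := by
  have h : IntegrableOn (fun v => octC * (4 * (v ^ 0 * octE v) + 3 * (4 * (v ^ 1 * octE v)) +
      3 * (4 * (v ^ 2 * octE v)) + 4 * (v ^ 3 * octE v))) (Ioo 0 1) :=
    ((((integrableOn_octR 0).add ((integrableOn_octR 1).const_mul 3)).add
      ((integrableOn_octR 2).const_mul 3)).add (integrableOn_octR 3)).const_mul octC
  exact h.congr_fun (fun v _ => by ring) measurableSet_Ioo

/-- `3c·4vE + (3c·4v²E + c·4v³E)` is integrable on `(0,1)`. -/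
theorem integrableOn_octT123 : IntegrableOn (fun v => 3 * octC * (4 * (v ^ 1 * octE v)) +
    (3 * octC * (4 * (v ^ 2 * octE v)) + octC * (4 * (v ^ 3 * octE v)))) (Ioo 0 1) :=
  (((integrableOn_octR 1).const_mul (3 * octC)).add
    (((integrableOn_octR 2).const_mul (3 * octC)).add ((integrableOn_octR 3).const_mul octC)))

/-- `3c·4v²E + c·4v³E` is integrable on `(0,1)`. -/
theorem integrableOn_octT23 : IntegrableOn (fun v => 3 * octC * (4 * (v ^ 2 * octE v)) +
    octC * (4 * (v ^ 3 * octE v))) (Ioo 0 1) :=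
  ((integrableOn_octR 2).const_mul (3 * octC)).add ((integrableOn_octR 3).const_mul octC)

/-! ## Semialgebraicity -/

/-- `E` is `ℚ`-semialgebraic on `(0,1)`. -/
theorem sa_octE : IsSemialgebraicFunOn ℚ (line (Ioo (0:ℝ) 1)) (fun x : Fin 1 → ℝ => octE (x 0)) := by
  have hP : IsSemialgebraicFunOn ℚ (line (Ioo (0:ℝ) 1)) (fun x : Fin 1 → ℝ => octP (x 0)) :=
    (isSemialgebraicFunOn_aeval mix_line_sa (X 0 * (1 - X 0 ^ 4) : MvPolynomial (Fin 1) ℚ)).congr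
      fun x _ => by simp [octP]
  refine (IsSemialgebraicFunOn.rpow_ratCast mix_line_sa hP (fun x hx => octP_pos hx)
    (-(5 / 6))).congr fun x _ => ?_
  simp only [octE]
  norm_num

/-- `p(v) E(v)` is `ℚ`-semialgebraic on `(0,1)` for a polynomial `p` over `ℚ`. -/
theorem sa_poly_octE (p : MvPolynomial (Fin 1) ℚ) : IsSemialgebraicFunOn ℚ (line (Ioo (0:ℝ) 1))
    (fun x : Fin 1 → ℝ => aeval x p * octE (x 0)) :=
  (IsSemialgebraicFunOn.mul_holds (isSemialgebraicFunOn_aeval mix_line_sa p) sa_octE).congr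
    fun x _ => by simp only [Pi.mul_apply]

/-- `4 x₀^j E(x₀)` is `ℚ`-semialgebraic on `(0,1)`. -/
theorem sa_octR (j : ℕ) : IsSemialgebraicFunOn ℚ (line (Ioo (0:ℝ) 1))
    (fun x : Fin 1 → ℝ => 4 * (x 0 ^ j * octE (x 0))) :=
  (sa_poly_octE (4 * X 0 ^ j)).congr fun x _ => by
    simp only [map_mul, map_pow, map_ofNat, aeval_X]; ring

/-- `a · p(v) E(v)` is `ℚ`-semialgebraic on `(0,1)` for `a` algebraic and `p` a polynomial over `ℚ`. -/
theorem sa_const_poly_octE {a : ℝ} (ha : IsAlgebraic ℚ a) (p : MvPolynomial (Fin 1) ℚ) :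
    IsSemialgebraicFunOn ℚ (line (Ioo (0:ℝ) 1))
      (fun x : Fin 1 → ℝ => a * (aeval x p * octE (x 0))) :=
  (IsSemialgebraicFunOn.mul_holds (isSemialgebraicFunOn_const_of_isAlgebraic mix_line_sa ha)
    (sa_poly_octE p)).congr fun x _ => by simp only [Pi.mul_apply]

/-- The integrand `c · 4(1+x₀)³E(x₀)` is `ℚ`-semialgebraic on `(0,1)`. -/
theorem sa_octS : IsSemialgebraicFunOn ℚ (line (Ioo (0:ℝ) 1))
    (fun x : Fin 1 → ℝ => octC * (4 * ((1 + x 0) ^ 3 * octE (x 0)))) :=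
  (sa_const_poly_octE isAlgebraic_octC (4 * (1 + X 0) ^ 3)).congr fun x _ => by
    simp only [map_mul, map_pow, map_add, map_one, map_ofNat, aeval_X]; ring

/-- The integrand `3c·4x₀E + (3c·4x₀²E + c·4x₀³E)` is `ℚ`-semialgebraic on `(0,1)`. -/
theorem sa_octT123 : IsSemialgebraicFunOn ℚ (line (Ioo (0:ℝ) 1))
    (fun x : Fin 1 → ℝ => 3 * octC * (4 * (x 0 ^ 1 * octE (x 0))) +
      (3 * octC * (4 * (x 0 ^ 2 * octE (x 0))) + octC * (4 * (x 0 ^ 3 * octE (x 0))))) :=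
  (sa_const_poly_octE isAlgebraic_octC (12 * X 0 + 12 * X 0 ^ 2 + 4 * X 0 ^ 3)).congr
    fun x _ => by simp only [map_mul, map_pow, map_add, map_ofNat, aeval_X]; ring

/-- The integrand `3c·4x₀²E + c·4x₀³E` is `ℚ`-semialgebraic on `(0,1)`. -/
theorem sa_octT23 : IsSemialgebraicFunOn ℚ (line (Ioo (0:ℝ) 1))
    (fun x : Fin 1 → ℝ => 3 * octC * (4 * (x 0 ^ 2 * octE (x 0))) +
      octC * (4 * (x 0 ^ 3 * octE (x 0)))) :=
  (sa_const_poly_octE isAlgebraic_octC (12 * X 0 ^ 2 + 4 * X 0 ^ 3)).congr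
    fun x _ => by simp only [map_mul, map_pow, map_add, map_ofNat, aeval_X]; ring

end

end SoloBlind

end Summit.KontsevichZagierPeriods.KontsevichZagierPeriods.Theorems
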